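import Summits.Ventures.Crystal3D.Theorems.StickyWulffConstantNoReconstructionGainConfinedCertificateThin
import Literature.Algebra.EuclideanLattices.FccBccLattices
import HarnessLib

/-!
# Height-confined `(111)` films: the windowed weighted-kissing bound PROVED for windows `W ≤ 1/2`
# (line `replication-exactness`, inside `stub_noCriminal`)

HONEST FRAMING. Part of the venture `Summits/Ventures/Crystal3D` (cell `crystal3d-full`), helper `--supports` the
crux `NoReconstructionGain` (stmt-Ventures-19144, route `route-Ventures-StickyWulffConstant`), lead wulff-p1 g20.
The thin case `confinedCodeBoundPhys_of_thin` (`…ConfinedCertificateThin`, `W ≤ 7/20`) used one geometric input about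
the film directions: at most SIX `60°`-code vectors fit in a height window of width `7/20`.  The same is true for width
`1/2` — and that is the whole extension: seven unit vectors with third coordinates in a common window
`[a, a + 1/2] ⊆ [−1/2, 1/2]` have two whose horizontal parts make an angle `≤ 2π/7`, and then
`⟪u, u'⟫ ≥ ζζ' + cos(2π/7)·√((1−ζ²)(1−ζ'²)) > 1/2` (`cos(2π/7) ≥ 61/100`; the polynomial margin is `≥ 1/100`).

* `cos_two_pi_div_seven_ge'` — `61/100 ≤ cos(2π/7)` (double angle from `1 − x²/2 ≤ cos x` at `π/7`);
* `seven_halfWindow_false`, `card_le_six_of_halfWindow` — at most six code vectors in a width-`1/2` window;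
* `confinedCodeBoundPhys_of_half` — `ConfinedCodeBoundPhys W g` for every `W ≤ 1/2` and every admissible profile
  (antitone, `g 0 = 1`, `g = 2` below `−√(2/3)`, `g(√(2/3) − √3/2) ≤ 4/3`, `g(√(2/3) − 1) ≤ 5/3`) — same plug
  count (`card_mul_sq_le_of_sameHeight`) as the thin case;
* `not_isCriminal_basal_of_height_le_half` — **UNCONDITIONAL**: over the close-packed layer `k` of `Λ₀`
  (`k√(2/3) ≤ s < (k+1)√(2/3)`) no film all of whose balls lie at height `≤ (k+1)√(2/3) + 1/2` is a criminal.

Where the method stands after this file (kernel): possible for `W ≤ 1/2`, impossible for `W ≥ 8/5`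
(`not_confinedCodeBoundPhys_eight_fifths`); numerically feasible to `W ≈ 1.2`.  WHAT THIS IS NOT: nothing about
wider windows or other faces; the crux and rung F-C1 not moved.
-/

noncomputable section

namespace Summit.Ventures.Crystal3D.Theorems

open Summit.Ventures.Crystal3D Finset Real
open Literature.Algebra.EuclideanLattices (inner_fin_three)
open scoped InnerProductSpace

/-! ## Seven code vectors do not fit in a height window of width `1/2` -/

/-- `cos (2π/7) ≥ 61/100`: `cos (π/7) ≥ 1 − (π/7)²/2 ≥ 0.898` and the double-angle formula. -/
theorem cos_two_pi_div_seven_ge' : (61 / 100 : ℝ) ≤ Real.cos (2 * π / 7) := by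
  have h1 := Real.one_sub_sq_div_two_le_cos (x := π / 7)
  have hπ := Real.pi_lt_d2
  have hπ0 := Real.pi_pos
  have hx : (π / 7) ^ 2 ≤ (9 / 20) ^ 2 := by
    apply pow_le_pow_left₀ (by positivity); linarith
  have hc7 : (898 : ℝ) / 1000 ≤ Real.cos (π / 7) := by nlinarith
  have h2 : Real.cos (2 * π / 7) = 2 * Real.cos (π / 7) ^ 2 - 1 := by
    rw [show 2 * π / 7 = 2 * (π / 7) by ring, Real.cos_two_mul]
  rw [h2]; nlinarith

/-- **Seven unit vectors in a height window of width `1/2` are not a `60°`-code.**  If `a ∈ [−1/2, 0]` and seven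
unit vectors of `ℝ³` have third coordinates in `[a, a + 1/2]`, two of them have inner product `> 1/2`. -/
theorem seven_halfWindow_false {a : ℝ} (ha : -(1 / 2) ≤ a) (ha0 : a ≤ 0) (u : Fin 7 → EuclideanSpace ℝ (Fin 3))
    (hu : ∀ i, ‖u i‖ = 1) (hwin : ∀ i, a ≤ u i 2 ∧ u i 2 ≤ a + 1 / 2)
    (hsep : ∀ i j, i ≠ j → ⟪u i, u j⟫_ℝ ≤ 1 / 2) : False := by
  have hsq : ∀ v : EuclideanSpace ℝ (Fin 3), ‖v‖ ^ 2 = v 0 ^ 2 + v 1 ^ 2 + v 2 ^ 2 := by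
    intro v; rw [EuclideanSpace.real_norm_sq_eq, Fin.sum_univ_three]
  -- horizontal parts as complex numbers
  set z : Fin 7 → ℂ := fun i => ⟨u i 0, u i 1⟩ with hz
  have hzn : ∀ i, ‖z i‖ ^ 2 = 1 - (u i 2) ^ 2 := by
    intro i
    rw [Complex.sq_norm, hz, Complex.normSq_mk]
    have := hsq (u i); rw [hu i, one_pow] at this
    nlinarith [this]
  have hζ : ∀ i, (u i 2) ^ 2 ≤ 1 / 4 := by
    intro i
    have h := hwin i
    nlinarith [h.1, h.2]
  have hne : ∀ i, z i ≠ 0 := by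
    intro i h
    have := hzn i
    rw [h, norm_zero] at this
    nlinarith [hζ i]
  obtain ⟨i, j, hij, hcos⟩ := exists_cos_sub_ge (fun i => Complex.arg (z i))
    (fun i => Complex.neg_pi_lt_arg _) (fun i => Complex.arg_le_pi _)
  have hc := cos_two_pi_div_seven_ge'
  have hre := re_mul_add_im_mul (z i) (z j) (hne i) (hne j)
  -- the inner product in coordinates
  have hin : ⟪u i, u j⟫_ℝ = ((z i).re * (z j).re + (z i).im * (z j).im) + u i 2 * u j 2 := by
    rw [inner_fin_three, hz]
  have hcos' : 61 / 100 ≤ Real.cos (Complex.arg (z i) - Complex.arg (z j)) := hc.trans hcos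
  set r₁ := ‖z i‖ with hr₁
  set r₂ := ‖z j‖ with hr₂
  set ζ₁ := u i 2 with hζ₁
  set ζ₂ := u j 2 with hζ₂
  have hr₁0 : 0 ≤ r₁ := norm_nonneg _
  have hr₂0 : 0 ≤ r₂ := norm_nonneg _
  have key : r₁ * r₂ * (61 / 100) ≤ r₁ * r₂ * Real.cos (Complex.arg (z i) - Complex.arg (z j)) :=
    mul_le_mul_of_nonneg_left hcos' (mul_nonneg hr₁0 hr₂0)
  have hij' := hsep i j hij
  rw [hin, hre] at hij'
  -- now `ζ₁ ζ₂ + (61/100) r₁ r₂ ≤ 1/2`, contradicting the window geometry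
  have hwi := hwin i
  have hwj := hwin j
  have hd : (ζ₁ - ζ₂) ^ 2 ≤ 1 / 4 := by nlinarith [hwi.1, hwi.2, hwj.1, hwj.2]
  have h1 : r₁ ^ 2 = 1 - ζ₁ ^ 2 := hzn i
  have h2 : r₂ ^ 2 = 1 - ζ₂ ^ 2 := hzn j
  have hpos : 0 ≤ 1 / 2 - ζ₁ * ζ₂ := by nlinarith [hζ i, hζ j, sq_nonneg (ζ₁ - ζ₂)]
  -- polynomial margin: (61/100)² (1−ζ₁²)(1−ζ₂²) > (1/2 − ζ₁ζ₂)²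
  have hpoly : (1 / 2 - ζ₁ * ζ₂) ^ 2 < ((61 : ℝ) / 100) ^ 2 * ((1 - ζ₁ ^ 2) * (1 - ζ₂ ^ 2)) := by
    nlinarith [hζ i, hζ j, hd, sq_nonneg (ζ₁ + ζ₂), sq_nonneg (ζ₁ - ζ₂), mul_nonneg (sub_nonneg.2 (hζ i)) (sub_nonneg.2 (hζ j)),
      sq_nonneg (ζ₁ * ζ₂), mul_nonneg (sub_nonneg.2 hd) (sq_nonneg (ζ₁ + ζ₂))]
  have hlt : 1 / 2 - ζ₁ * ζ₂ < 61 / 100 * (r₁ * r₂) := by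
    have hsq' : (1 / 2 - ζ₁ * ζ₂) ^ 2 < (61 / 100 * (r₁ * r₂)) ^ 2 := by
      rw [mul_pow, mul_pow, h1, h2]; exact hpoly
    exact lt_of_pow_lt_pow_left₀ 2 (by positivity) hsq'
  nlinarith [key, hij', hlt]

/-- **At most six code vectors in a height window of width `1/2`.** -/
theorem card_le_six_of_halfWindow (F : Finset (EuclideanSpace ℝ (Fin 3))) {a W : ℝ} (hW : W ≤ 1 / 2)
    (ha : -(1 / 2) ≤ a) (ha0 : a ≤ 0)
    (h1 : ∀ u ∈ F, ‖u‖ = 1) (h2 : ∀ u ∈ F, ∀ v ∈ F, u ≠ v → ⟪u, v⟫_ℝ ≤ 1 / 2)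
    (hwin : ∀ u ∈ F, a ≤ u 2 ∧ u 2 ≤ a + W) : F.card ≤ 6 := by
  classical
  by_contra h7
  have h7' : 7 ≤ F.card := by omega
  obtain ⟨T, hT, hTc⟩ := Finset.exists_subset_card_eq h7'
  set f := (T.equivFinOfCardEq hTc).symm with hf
  have hmem : ∀ i, ((f i : EuclideanSpace ℝ (Fin 3)) ∈ F) := fun i => hT (f i).2
  refine seven_halfWindow_false ha ha0 (fun i => (f i : EuclideanSpace ℝ (Fin 3))) (fun i => h1 _ (hmem i))
    (fun i => ⟨(hwin _ (hmem i)).1, (hwin _ (hmem i)).2.trans (by linarith)⟩) (fun i j hij => ?_)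
  have hne : (f i : EuclideanSpace ℝ (Fin 3)) ≠ f j := fun h => hij (f.injective (Subtype.ext h))
  exact h2 _ (hmem i) _ (hmem j) hne

/-! ## The windowed bound for `W ≤ 1/2` -/

/-- **`ConfinedCodeBoundPhys W g` for every window `W ≤ 1/2`** and every admissible profile (same hypotheses and
the same plug count as `confinedCodeBoundPhys_of_thin`; the film count is `card_le_six_of_halfWindow`). -/
theorem confinedCodeBoundPhys_of_half {W : ℝ} (hW : W ≤ 1 / 2) {g : ℝ → ℝ} (hg : Antitone g)
    (hg0 : g 0 = 1) (hplug : ∀ z, z ≤ -Real.sqrt (2 / 3) → g z = 2)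
    (hg2 : g (Real.sqrt (2 / 3) - Real.sqrt 3 / 2) ≤ 4 / 3) (hg1 : g (Real.sqrt (2 / 3) - 1) ≤ 5 / 3) :
    ConfinedCodeBoundPhys W g := by
  classical
  intro a haW ha0 N h1 h2 h3
  set c : ℝ := Real.sqrt (2 / 3) with hc
  have hc2 : c ^ 2 = 2 / 3 := Real.sq_sqrt (by norm_num)
  have hcpos : 0 < c := Real.sqrt_pos.2 (by norm_num)
  have h3sq : Real.sqrt 3 ^ 2 = 3 := Real.sq_sqrt (by norm_num)
  have h3pos : 0 < Real.sqrt 3 := Real.sqrt_pos.2 (by norm_num)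
  set P := N.filter (fun u => u 2 = a - c) with hP
  set F := N.filter (fun u => ¬ u 2 = a - c) with hF
  have hsplit : ∑ u ∈ N, g (u 2) = ∑ u ∈ P, g (u 2) + ∑ u ∈ F, g (u 2) :=
    (Finset.sum_filter_add_sum_filter_not N (fun u => u 2 = a - c) (fun u => g (u 2))).symm
  have hPN : ∀ u ∈ P, u ∈ N ∧ u 2 = a - c := fun u hu => Finset.mem_filter.1 hu
  have hFN : ∀ u ∈ F, u ∈ N ∧ a ≤ u 2 ∧ u 2 ≤ a + W := by
    intro u hu
    obtain ⟨huN, hne⟩ := Finset.mem_filter.1 hu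
    exact ⟨huN, (h3 u huN).resolve_left hne⟩
  have hPsum : ∑ u ∈ P, g (u 2) = 2 * (P.card : ℝ) := by
    rw [Finset.sum_congr rfl fun u hu => by rw [(hPN u hu).2, hplug (a - c) (by linarith)], Finset.sum_const,
      nsmul_eq_mul, mul_comm]
  have hm := card_mul_sq_le_of_sameHeight P (a - c) (fun u hu => h1 u (hPN u hu).1)
    (fun u hu v hv huv => h2 u (hPN u hu).1 v (hPN v hv).1 huv) (fun u hu => (hPN u hu).2)
  have hFcard : F.card ≤ 6 :=
    card_le_six_of_halfWindow F hW (by linarith) ha0 (fun u hu => h1 u (hFN u hu).1)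
      (fun u hu v hv huv => h2 u (hFN u hu).1 v (hFN v hv).1 huv) (fun u hu => (hFN u hu).2)
  have hga_nonneg : 0 ≤ g a := by
    have : g a ≥ g 0 := hg ha0
    linarith
  have hFsum : ∑ u ∈ F, g (u 2) ≤ 6 * g a := by
    calc ∑ u ∈ F, g (u 2) ≤ ∑ u ∈ F, g a := Finset.sum_le_sum fun u hu => hg (hFN u hu).2.1
      _ = (F.card : ℝ) * g a := by rw [Finset.sum_const, nsmul_eq_mul]
      _ ≤ 6 * g a := by
        have : (F.card : ℝ) ≤ 6 := by exact_mod_cast hFcard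
        exact mul_le_mul_of_nonneg_right this hga_nonneg
  rw [hsplit, hPsum]
  have hm3 : P.card ≤ 3 := by
    by_contra h4
    have h4' : (4 : ℝ) ≤ P.card := by exact_mod_cast (by omega : 4 ≤ P.card)
    have hz : 2 / 3 ≤ (a - c) ^ 2 := by nlinarith
    nlinarith [hm, hz]
  have hc35 : (1 : ℝ) / 2 ≤ c := by nlinarith
  have hga2 : g a ≤ 2 := by
    have : g a ≤ g (-c) := hg (by linarith)
    rw [hplug (-c) (by linarith)] at this; exact this
  interval_cases hPc : P.card
  · simp only [Nat.cast_zero, mul_zero, zero_add]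
    linarith
  · have hz1 : (a - c) ^ 2 ≤ 1 := by
      have h := hm; simp only [Nat.cast_one, one_mul] at h; linarith
    have ha1 : c - 1 ≤ a := by nlinarith
    have : g a ≤ g (c - 1) := hg ha1
    simp only [Nat.cast_one]
    linarith
  · have hz2 : (a - c) ^ 2 ≤ 3 / 4 := by
      have h := hm; simp only [Nat.cast_ofNat] at h; linarith
    have ha2 : c - Real.sqrt 3 / 2 ≤ a := by nlinarith
    have : g a ≤ g (c - Real.sqrt 3 / 2) := hg ha2
    simp only [Nat.cast_ofNat]
    linarith
  · have hz3 : (a - c) ^ 2 ≤ 2 / 3 := by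
      have h := hm; simp only [Nat.cast_ofNat] at h; linarith
    have ha3 : a = 0 := by nlinarith
    rw [ha3, hg0] at hFsum
    simp only [Nat.cast_ofNat]
    linarith

/-! ## The unconditional film theorem -/

/-- **No `(111)` criminal below height `(k+1)√(2/3) + 1/2`** — unconditionally (certificate: the clipped linear ramp
`g z = min 2 (max 0 (1 − z/√(2/3)))`, as in `not_isCriminal_basal_of_height_le_thin`, now with the width-`1/2` film
count). -/
theorem not_isCriminal_basal_of_height_le_half (k : ℤ) {s : ℝ} (hs : (k : ℝ) * Real.sqrt (2 / 3) ≤ s)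
    (hs' : s < ((k : ℝ) + 1) * Real.sqrt (2 / 3)) {Q : Finset (EuclideanSpace ℝ (Fin 3))}
    (hconf : ∀ q ∈ Q, q 2 ≤ ((k : ℝ) + 1) * Real.sqrt (2 / 3) + 1 / 2) :
    ¬ IsCriminal (EuclideanSpace.single 2 (1 : ℝ)) s Q := by
  set c : ℝ := Real.sqrt (2 / 3) with hc
  have hc2 : c ^ 2 = 2 / 3 := Real.sq_sqrt (by norm_num)
  have hcpos : 0 < c := Real.sqrt_pos.2 (by norm_num)
  have h3sq : Real.sqrt 3 ^ 2 = 3 := Real.sq_sqrt (by norm_num)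
  have h3pos : 0 < Real.sqrt 3 := Real.sqrt_pos.2 (by norm_num)
  set g : ℝ → ℝ := fun z => min 2 (max 0 (1 - z / c)) with hg
  have hclip : ∀ t : ℝ, min 2 (max 0 (1 - t)) + min 2 (max 0 (1 + t)) = 2 := by
    intro t
    simp only [min_def, max_def]
    split_ifs <;> linarith
  have hsym : ∀ z, g z + g (-z) = 2 := by
    intro z
    have h := hclip (z / c)
    simp only [hg, neg_div]
    rwa [sub_neg_eq_add]
  have hanti : Antitone g := by
    intro x y hxy
    simp only [hg]
    have : 1 - y / c ≤ 1 - x / c := by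
      have := div_le_div_of_nonneg_right hxy hcpos.le; linarith
    exact min_le_min le_rfl (max_le_max le_rfl this)
  have hg0 : g 0 = 1 := by simp [hg]
  have hplug : ∀ z, z ≤ -c → g z = 2 := by
    intro z hz
    simp only [hg]
    have h1 : 2 ≤ 1 - z / c := by
      have : z / c ≤ -1 := by rw [div_le_iff₀ hcpos]; linarith
      linarith
    rw [max_eq_right (by linarith), min_eq_left h1]
  have hplug' : ∀ z, z ≤ -Real.sqrt (2 / 3) → g z = 2 := fun z hz => hplug z (by rw [hc]; exact hz)
  have hval : ∀ t, 0 ≤ t → t ≤ 2 * c → g (c - t) = t / c := by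
    intro t ht0 htc
    simp only [hg]
    have e : 1 - (c - t) / c = t / c := by field_simp; ring
    have h2 : t / c ≤ 2 := by rw [div_le_iff₀ hcpos]; linarith
    rw [e, max_eq_right (div_nonneg ht0 hcpos.le), min_eq_right h2]
  have hg2 : g (c - Real.sqrt 3 / 2) ≤ 4 / 3 := by
    rw [hval _ (by positivity) (by nlinarith [mul_pos hcpos h3pos]), div_le_iff₀ hcpos]
    nlinarith [mul_pos hcpos h3pos]
  have hg1 : g (c - 1) ≤ 5 / 3 := by
    rw [hval 1 zero_le_one (by nlinarith), div_le_iff₀ hcpos]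
    nlinarith
  exact not_isCriminal_basal_of_confinedCodeBoundPhys k hs hs' hsym hplug'
    (confinedCodeBoundPhys_of_half le_rfl hanti hg0 hplug' hg2 hg1) hconf

end Summit.Ventures.Crystal3D.Theorems

end
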